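import Mathlib
import HarnessLib.Audit
import Summits.PneNP.PneNP.Theorems.PstarChordReadOutsideClean

/-!
# Rank one between a PRIVATE flip and a SWITCH flip: uniform type and the INVISIBLE/FULL dichotomy WITH couplings (memo g21 §16, steps 1–2)

FRONTIER range-avoidance ladder, rung F-N3, ROUND 24 (cell `pnp-ideate`, prover-2 memo `g21/O1-CHORD-READ-g21.md` §16 (the general two-chord
theorem); typed target `PstarCoreBoundTargets.TerminalPeelable` (p646951); restricted-model proof complexity — nothing here bears on `P` versus
`NP`).

The affine two-chord theorem (`PstarChordReadOutsideKill`) compares the SWITCHES `zᵢ, zⱼ` of two outside gates `(vᵢ, zᵢ)`, `(vⱼ, zⱼ)` on two chords,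
so it needs them UNCOUPLED (no monomial `(zᵢ, zⱼ)`).  Comparing instead the PRIVATE `vᵢ` (flipped while its co-private is `0`) with the SWITCH
`zⱼ` — two flips that always commute, since `zⱼ` is not a partner of `vᵢ` — gives the same conclusions with NO coupling hypothesis:

* `dir_parallel` — at every solution with both co-privates `0`, the direction `dᵢ = (mv₁ vᵢ, mv₂ vᵢ)` of the private is parallel to the TYPE of
  `gⱼ` (two-point lemma under the `vⱼ`-flip);  `type_eq'` — hence the types of `gᵢ` and `gⱼ` are equal (the `zᵢ`-flip moves `dᵢ` by the type
  of `gᵢ`; `type_eq_of_parallel`);  `not_mem_lin₂'` — in type `(1,0)` the gated private is not read by `Γ₂`;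
* `mv₂_eq_of_typeI` — in type `(1,0)` at `cⱼ` (gate `gⱼ ∈ G₁ ∖ G₂`, `Γ₂` blind to `vⱼ`), for an outside `z` in no monomial with `vⱼ` and every
  solution with `cⱼ`'s co-private `0`:  `mv₂ z = κ ∧ ¬ live₁(vⱼ)` where `κ = [zⱼ is a G₂-partner of z]` and `live₁(vⱼ) = mv₁ vⱼ` (rank one of
  `(z, vⱼ)` where `vⱼ` is live, transported by the `zⱼ`-flip);
* `eq_empty_of_chordLocal_lin` — a LINEAR G-constraint on variables off the chord that is chord-local is empty (indicator test);
* `invisible_of_mv₂_zero` / `full_of_mv₂_eq` — the **INVISIBLE / FULL dichotomy**: by the slice lemma at `cⱼ` with the EMPTY menu, either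
  `z` is invisible to `Γ₂` (`κ = 0`), or (`κ = 1`) the G₂-partners of `z` are EXACTLY the partners of `vⱼ` and `[z ∈ C₂] = ¬[vⱼ ∈ C₁]`.

No realisability hypotheses; no Assumption A.
-/

set_option linter.dupNamespace false -- `Summit.PneNP.PneNP.…`: summit = sub-problem name (D-0017 single-conjunct layout)

open Finset Literature.Computability.Complexity
open scoped symmDiff
open Summit.PneNP.PneNP.Theorems.PstarFibrePolys (bit bit_injective)
open Summit.PneNP.PneNP.Theorems.PstarTyped (Typed)
open Summit.PneNP.PneNP.Theorems.PstarSALevel (varSet bdry BoundaryExpanding SimpleOverlap)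
open Summit.PneNP.PneNP.Theorems.PstarGapPeeling (not_mem_varSet_of_private)
open Summit.PneNP.PneNP.Theorems.PstarCentreFree (vars_mem_varSet)
open Summit.PneNP.PneNP.Theorems.PstarGapOneAll (gval)
open Summit.PneNP.PneNP.Theorems.PstarGConstraint (gval_false gval_update_of_forall_ne)
open Summit.PneNP.PneNP.Theorems.PstarGSystemFreeVar (gval_symmDiff)
open Summit.PneNP.PneNP.Theorems.PstarChordRepair (IsChord)
open Summit.PneNP.PneNP.Theorems.PstarCoreBoundTargets (Terminal)
open Summit.PneNP.PneNP.Theorems.PstarChordReadSwitch (solves_update_of_outside)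
open Summit.PneNP.PneNP.Theorems.PstarChordReadLemma (ChordLocal SliceGeneric chordLocal_of_fail_slice)
open Summit.PneNP.PneNP.Theorems.PstarChordReadGates (sliceGeneric_mono)
open Summit.PneNP.PneNP.Theorems.PstarChordReadFlip
open Summit.PneNP.PneNP.Theorems.PstarChordReadOutside
open Summit.PneNP.PneNP.Theorems.PstarChordReadOutsideClean

namespace Summit.PneNP.PneNP.Theorems.PstarChordReadPrivSwitch

variable {n m : ℕ}

/-- If `det(m, d) = 0` and `det(m, d ⊕ l) = 0` with the types `l, m` non-zero, then `l = m`. -/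
theorem type_eq_of_parallel (d₁ d₂ l₁ l₂ m₁ m₂ : Bool) (hl : (l₁ || l₂) = true) (hm : (m₁ || m₂) = true)
    (h0 : (m₁ && d₂) = (d₁ && m₂)) (h1 : (m₁ && xor d₂ l₂) = (xor d₁ l₁ && m₂)) : l₁ = m₁ ∧ l₂ = m₂ := by
  revert d₁ d₂ l₁ l₂ m₁ m₂ hl hm h0 h1; decide

section Dir

variable {I : LocalMap 4 n m} {r : ℕ} {y : Fin m → Bool} {J₀ : Finset (Fin m)} {w₁ w₂ : Finset (Fin n) × Finset (Fin m) × Bool}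
  {cᵢ cⱼ gᵢ gⱼ : Fin m} {vᵢ vᵢ' zᵢ vⱼ vⱼ' zⱼ : Fin n}

/-- **The direction of a gated private is parallel to the type of the other chord's gate.**  Chords `cᵢ ≠ cⱼ` (co-privates `vᵢ', vⱼ'`), an outside
gate `gⱼ = (vⱼ, zⱼ)` on `cⱼ` with `zⱼ` in no monomial with `vᵢ`, no cross monomial `(vᵢ, vⱼ)`, a solution with both co-privates `0`:
`det(type gⱼ, (mv₁ vᵢ, mv₂ vᵢ)) = 0` there. -/
theorem dir_parallel (hI : I.IsPure xorAndPred) (hS : SimpleOverlap I) (ht : Terminal I r y J₀ w₁ w₂) (hcᵢ : cᵢ ∈ J₀) (hcⱼ : cⱼ ∈ J₀)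
    (hne : cᵢ ≠ cⱼ) (hchᵢ : IsChord I J₀ cᵢ) (hchⱼ : IsChord I J₀ cⱼ)
    (hvᵢ : (I.vars cᵢ 2 = vᵢ ∧ I.vars cᵢ 3 = vᵢ') ∨ (I.vars cᵢ 2 = vᵢ' ∧ I.vars cᵢ 3 = vᵢ))
    (hvⱼ : (I.vars cⱼ 2 = vⱼ ∧ I.vars cⱼ 3 = vⱼ') ∨ (I.vars cⱼ 2 = vⱼ' ∧ I.vars cⱼ 3 = vⱼ))
    (hpⱼ : (I.vars gⱼ 2 = vⱼ ∧ I.vars gⱼ 3 = zⱼ) ∨ (I.vars gⱼ 2 = zⱼ ∧ I.vars gⱼ 3 = vⱼ)) (hzⱼ : ∀ j ∈ J₀, zⱼ ∉ varSet I j)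
    (hncross : ∀ h ∈ w₁.2.1 ∪ w₂.2.1, ¬ ((I.vars h 2 = vᵢ ∧ I.vars h 3 = vⱼ) ∨ (I.vars h 2 = vⱼ ∧ I.vars h 3 = vᵢ)))
    (hnoⱼ : ∀ h ∈ w₁.2.1 ∪ w₂.2.1, ¬ ((I.vars h 2 = vᵢ ∧ I.vars h 3 = zⱼ) ∨ (I.vars h 2 = zⱼ ∧ I.vars h 3 = vᵢ)))
    {x : Fin n → Bool} (hx : ∀ j ∈ J₀, I.eval x j = y j) (h0ᵢ : x vᵢ' = false) (h0ⱼ : x vⱼ' = false) :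
    (decide (gⱼ ∈ w₁.2.1) && mv I w₂.1 w₂.2.1 vᵢ x) = (mv I w₁.1 w₁.2.1 vᵢ x && decide (gⱼ ∈ w₂.2.1)) := by
  classical
  have memᵢ : vᵢ ∈ varSet I cᵢ ∧ vᵢ' ∈ varSet I cᵢ ∧ vᵢ ∈ bdry I J₀ := by
    rcases hvᵢ with ⟨h2, h3⟩ | ⟨h2, h3⟩
    · exact ⟨h2 ▸ vars_mem_varSet I cᵢ 2, h3 ▸ vars_mem_varSet I cᵢ 3, h2 ▸ hchᵢ.1⟩
    · exact ⟨h3 ▸ vars_mem_varSet I cᵢ 3, h2 ▸ vars_mem_varSet I cᵢ 2, h3 ▸ hchᵢ.2⟩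
  have memⱼ : vⱼ ∈ varSet I cⱼ ∧ vⱼ ∈ bdry I J₀ := by
    rcases hvⱼ with ⟨h2, -⟩ | ⟨-, h3⟩
    · exact ⟨h2 ▸ vars_mem_varSet I cⱼ 2, h2 ▸ hchⱼ.1⟩
    · exact ⟨h3 ▸ vars_mem_varSet I cⱼ 3, h3 ▸ hchⱼ.2⟩
  have hvⱼᵢ' : vⱼ ≠ vᵢ' := fun e => not_mem_varSet_of_private I hcⱼ hcᵢ hne memⱼ.2 memⱼ.1 (e ▸ memᵢ.2.1)
  have hvzⱼ : vⱼ ≠ zⱼ := fun e => hzⱼ cⱼ hcⱼ (e ▸ memⱼ.1)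
  set x' := Function.update x vⱼ (!x vⱼ) with hx'
  have hs' : ∀ j ∈ J₀, I.eval x' j = y j := solves_update_priv hI hcⱼ hchⱼ hvⱼ hx h0ⱼ _
  have h0ᵢ' : x' vᵢ' = false := by rw [hx', Function.update_of_ne hvⱼᵢ'.symm]; exact h0ᵢ
  have R₀ := rank_one_out_priv hI ht hzⱼ hcᵢ hchᵢ hvᵢ hnoⱼ hx h0ᵢ
  have R₁ := rank_one_out_priv hI ht hzⱼ hcᵢ hchᵢ hvᵢ hnoⱼ hs' h0ᵢ'
  have A : ∀ (C : Finset (Fin n)) (G : Finset (Fin m)), mv I C G zⱼ x' = xor (mv I C G zⱼ x) (decide (gⱼ ∈ G)) :=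
    fun C G => mv_flip_gate hI hS C G hpⱼ hvzⱼ x
  have B : ∀ (C : Finset (Fin n)) (G : Finset (Fin m)), G ⊆ w₁.2.1 ∪ w₂.2.1 → mv I C G vᵢ x' = mv I C G vᵢ x :=
    fun C G hG => mv_update_of_ne I C G (fun h hh => hncross h (hG hh)) x _
  rw [A, A, B _ _ subset_union_left, B _ _ subset_union_right] at R₁
  exact parallel_of_two_point _ _ _ _ _ _ R₀ R₁

/-- **UNIFORM TYPE without the coupling hypothesis.**  As in `dir_parallel`, plus the outside gate `gᵢ = (vᵢ, zᵢ)` on `cᵢ` and both gates monomials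
of the readers: the two gates have the same type. -/
theorem type_eq' (hI : I.IsPure xorAndPred) (hS : SimpleOverlap I) (ht : Terminal I r y J₀ w₁ w₂) (hcᵢ : cᵢ ∈ J₀) (hcⱼ : cⱼ ∈ J₀)
    (hne : cᵢ ≠ cⱼ) (hchᵢ : IsChord I J₀ cᵢ) (hchⱼ : IsChord I J₀ cⱼ)
    (hvᵢ : (I.vars cᵢ 2 = vᵢ ∧ I.vars cᵢ 3 = vᵢ') ∨ (I.vars cᵢ 2 = vᵢ' ∧ I.vars cᵢ 3 = vᵢ))
    (hvⱼ : (I.vars cⱼ 2 = vⱼ ∧ I.vars cⱼ 3 = vⱼ') ∨ (I.vars cⱼ 2 = vⱼ' ∧ I.vars cⱼ 3 = vⱼ))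
    (hgᵢ : gᵢ ∈ w₁.2.1 ∪ w₂.2.1) (hpᵢ : (I.vars gᵢ 2 = vᵢ ∧ I.vars gᵢ 3 = zᵢ) ∨ (I.vars gᵢ 2 = zᵢ ∧ I.vars gᵢ 3 = vᵢ))
    (hzᵢ : ∀ j ∈ J₀, zᵢ ∉ varSet I j)
    (hgⱼ : gⱼ ∈ w₁.2.1 ∪ w₂.2.1) (hpⱼ : (I.vars gⱼ 2 = vⱼ ∧ I.vars gⱼ 3 = zⱼ) ∨ (I.vars gⱼ 2 = zⱼ ∧ I.vars gⱼ 3 = vⱼ))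
    (hzⱼ : ∀ j ∈ J₀, zⱼ ∉ varSet I j)
    (hncross : ∀ h ∈ w₁.2.1 ∪ w₂.2.1, ¬ ((I.vars h 2 = vᵢ ∧ I.vars h 3 = vⱼ) ∨ (I.vars h 2 = vⱼ ∧ I.vars h 3 = vᵢ)))
    (hnoⱼ : ∀ h ∈ w₁.2.1 ∪ w₂.2.1, ¬ ((I.vars h 2 = vᵢ ∧ I.vars h 3 = zⱼ) ∨ (I.vars h 2 = zⱼ ∧ I.vars h 3 = vᵢ)))
    {x : Fin n → Bool} (hx : ∀ j ∈ J₀, I.eval x j = y j) (h0ᵢ : x vᵢ' = false) (h0ⱼ : x vⱼ' = false) :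
    decide (gᵢ ∈ w₁.2.1) = decide (gⱼ ∈ w₁.2.1) ∧ decide (gᵢ ∈ w₂.2.1) = decide (gⱼ ∈ w₂.2.1) := by
  classical
  have memᵢ : vᵢ ∈ varSet I cᵢ ∧ vᵢ' ∈ varSet I cᵢ := by
    rcases hvᵢ with ⟨h2, h3⟩ | ⟨h2, h3⟩
    · exact ⟨h2 ▸ vars_mem_varSet I cᵢ 2, h3 ▸ vars_mem_varSet I cᵢ 3⟩
    · exact ⟨h3 ▸ vars_mem_varSet I cᵢ 3, h2 ▸ vars_mem_varSet I cᵢ 2⟩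
  have memⱼ' : vⱼ' ∈ varSet I cⱼ := by
    rcases hvⱼ with ⟨-, h3⟩ | ⟨h2, -⟩
    · exact h3 ▸ vars_mem_varSet I cⱼ 3
    · exact h2 ▸ vars_mem_varSet I cⱼ 2
  have hzvᵢ : zᵢ ≠ vᵢ := fun e => hzᵢ cᵢ hcᵢ (e ▸ memᵢ.1)
  have hzvᵢ' : zᵢ ≠ vᵢ' := fun e => hzᵢ cᵢ hcᵢ (e ▸ memᵢ.2)
  have hzvⱼ' : zᵢ ≠ vⱼ' := fun e => hzᵢ cⱼ hcⱼ (e ▸ memⱼ')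
  -- at `x` and at `x ⊕ e_{zᵢ}`
  set x'' := Function.update x zᵢ (!x zᵢ) with hx''
  have hs'' : ∀ j ∈ J₀, I.eval x'' j = y j := solves_update_of_outside hzᵢ hx _
  have h0ᵢ'' : x'' vᵢ' = false := by rw [hx'', Function.update_of_ne hzvᵢ'.symm]; exact h0ᵢ
  have h0ⱼ'' : x'' vⱼ' = false := by rw [hx'', Function.update_of_ne hzvⱼ'.symm]; exact h0ⱼ
  have P₀ := dir_parallel hI hS ht hcᵢ hcⱼ hne hchᵢ hchⱼ hvᵢ hvⱼ hpⱼ hzⱼ hncross hnoⱼ hx h0ᵢ h0ⱼ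
  have P₁ := dir_parallel hI hS ht hcᵢ hcⱼ hne hchᵢ hchⱼ hvᵢ hvⱼ hpⱼ hzⱼ hncross hnoⱼ hs'' h0ᵢ'' h0ⱼ''
  have A : ∀ (C : Finset (Fin n)) (G : Finset (Fin m)), mv I C G vᵢ x'' = xor (mv I C G vᵢ x) (decide (gᵢ ∈ G)) :=
    fun C G => mv_flip_gate hI hS C G hpᵢ.symm hzvᵢ x
  rw [A, A] at P₁
  have hl : (decide (gᵢ ∈ w₁.2.1) || decide (gᵢ ∈ w₂.2.1)) = true := by
    rcases mem_union.1 hgᵢ with h | h <;> simp [h]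
  have hm : (decide (gⱼ ∈ w₁.2.1) || decide (gⱼ ∈ w₂.2.1)) = true := by
    rcases mem_union.1 hgⱼ with h | h <;> simp [h]
  exact type_eq_of_parallel _ _ _ _ _ _ hl hm P₀ P₁

/-- **In type `(1,0)` the gated private is not read by `Γ₂`** (coupling-free version of `not_mem_lin₂_of_typeI`): as in `dir_parallel` with
`gⱼ ∈ G₁ ∖ G₂` and no monomial of `G₂` on `vᵢ`. -/
theorem not_mem_lin₂' (hI : I.IsPure xorAndPred) (hS : SimpleOverlap I) (ht : Terminal I r y J₀ w₁ w₂) (hcᵢ : cᵢ ∈ J₀) (hcⱼ : cⱼ ∈ J₀)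
    (hne : cᵢ ≠ cⱼ) (hchᵢ : IsChord I J₀ cᵢ) (hchⱼ : IsChord I J₀ cⱼ)
    (hvᵢ : (I.vars cᵢ 2 = vᵢ ∧ I.vars cᵢ 3 = vᵢ') ∨ (I.vars cᵢ 2 = vᵢ' ∧ I.vars cᵢ 3 = vᵢ))
    (hvⱼ : (I.vars cⱼ 2 = vⱼ ∧ I.vars cⱼ 3 = vⱼ') ∨ (I.vars cⱼ 2 = vⱼ' ∧ I.vars cⱼ 3 = vⱼ))
    (hgⱼ₁ : gⱼ ∈ w₁.2.1) (hgⱼ₂ : gⱼ ∉ w₂.2.1) (hpⱼ : (I.vars gⱼ 2 = vⱼ ∧ I.vars gⱼ 3 = zⱼ) ∨ (I.vars gⱼ 2 = zⱼ ∧ I.vars gⱼ 3 = vⱼ))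
    (hzⱼ : ∀ j ∈ J₀, zⱼ ∉ varSet I j)
    (hncross : ∀ h ∈ w₁.2.1 ∪ w₂.2.1, ¬ ((I.vars h 2 = vᵢ ∧ I.vars h 3 = vⱼ) ∨ (I.vars h 2 = vⱼ ∧ I.vars h 3 = vᵢ)))
    (hnoⱼ : ∀ h ∈ w₁.2.1 ∪ w₂.2.1, ¬ ((I.vars h 2 = vᵢ ∧ I.vars h 3 = zⱼ) ∨ (I.vars h 2 = zⱼ ∧ I.vars h 3 = vᵢ)))
    (hG₂vᵢ : ∀ g ∈ w₂.2.1, I.vars g 2 ≠ vᵢ ∧ I.vars g 3 ≠ vᵢ)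
    {x : Fin n → Bool} (hx : ∀ j ∈ J₀, I.eval x j = y j) (h0ᵢ : x vᵢ' = false) (h0ⱼ : x vⱼ' = false) : vᵢ ∉ w₂.1 := by
  intro hC
  have P := dir_parallel hI hS ht hcᵢ hcⱼ hne hchᵢ hchⱼ hvᵢ hvⱼ hpⱼ hzⱼ hncross hnoⱼ hx h0ᵢ h0ⱼ
  rw [decide_eq_true hgⱼ₁, decide_eq_false hgⱼ₂, mv_of_lin I hI hS hC hG₂vᵢ] at P
  simp at P

end Dir

/-! ## The INVISIBLE / FULL dichotomy -/
section Kappa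

variable {I : LocalMap 4 n m} {r : ℕ} {y : Fin m → Bool} {J₀ : Finset (Fin m)} {w₁ w₂ : Finset (Fin n) × Finset (Fin m) × Bool}
  {cⱼ gⱼ : Fin m} {vⱼ vⱼ' zⱼ z : Fin n}

/-- A variable not read linearly and in no monomial does not move the reader. -/
theorem mv_eq_false_of_invisible (hI : I.IsPure xorAndPred) (hS : SimpleOverlap I) {C : Finset (Fin n)} {G : Finset (Fin m)} {v : Fin n}
    (hC : v ∉ C) (hG : ∀ g ∈ G, I.vars g 2 ≠ v ∧ I.vars g 3 ≠ v) (x : Fin n → Bool) : mv I C G v x = false := by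
  rw [mv_eq_partners I hI hS, partners_eq_empty I hG, gval_empty, decide_eq_false hC]; rfl

/-- **The move of an outside variable in type `(1,0)`: `mv₂ z = κ ∧ ¬live₁(vⱼ)` on the slice.**  Gate `gⱼ = (vⱼ, zⱼ) ∈ G₁ ∖ G₂` on `cⱼ` (co-private
`vⱼ'`), `Γ₂` blind to `vⱼ`, `z` outside in no monomial with `vⱼ`; then at every solution with `x_{vⱼ'} = 0`:
`mv₂ z x = [zⱼ ∈ partners G₂ z] ∧ ¬ mv₁ vⱼ x`. -/
theorem mv₂_eq_of_typeI (hI : I.IsPure xorAndPred) (hS : SimpleOverlap I) (ht : Terminal I r y J₀ w₁ w₂) (hcⱼ : cⱼ ∈ J₀)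
    (hchⱼ : IsChord I J₀ cⱼ) (hvⱼ : (I.vars cⱼ 2 = vⱼ ∧ I.vars cⱼ 3 = vⱼ') ∨ (I.vars cⱼ 2 = vⱼ' ∧ I.vars cⱼ 3 = vⱼ))
    (hgⱼ₁ : gⱼ ∈ w₁.2.1) (hpⱼ : (I.vars gⱼ 2 = vⱼ ∧ I.vars gⱼ 3 = zⱼ) ∨ (I.vars gⱼ 2 = zⱼ ∧ I.vars gⱼ 3 = vⱼ))
    (hzⱼ : ∀ j ∈ J₀, zⱼ ∉ varSet I j) (hvC : vⱼ ∉ w₂.1) (hvG : ∀ g ∈ w₂.2.1, I.vars g 2 ≠ vⱼ ∧ I.vars g 3 ≠ vⱼ)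
    (hz : ∀ j ∈ J₀, z ∉ varSet I j)
    (hnoz : ∀ h ∈ w₁.2.1 ∪ w₂.2.1, ¬ ((I.vars h 2 = vⱼ ∧ I.vars h 3 = z) ∨ (I.vars h 2 = z ∧ I.vars h 3 = vⱼ)))
    {x : Fin n → Bool} (hx : ∀ j ∈ J₀, I.eval x j = y j) (h0ⱼ : x vⱼ' = false) :
    mv I w₂.1 w₂.2.1 z x = (decide (zⱼ ∈ partners I w₂.2.1 z) && !mv I w₁.1 w₁.2.1 vⱼ x) := by
  classical
  have memⱼ : vⱼ ∈ varSet I cⱼ ∧ vⱼ' ∈ varSet I cⱼ := by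
    rcases hvⱼ with ⟨h2, h3⟩ | ⟨h2, h3⟩
    · exact ⟨h2 ▸ vars_mem_varSet I cⱼ 2, h3 ▸ vars_mem_varSet I cⱼ 3⟩
    · exact ⟨h3 ▸ vars_mem_varSet I cⱼ 3, h2 ▸ vars_mem_varSet I cⱼ 2⟩
  have hzⱼvⱼ : zⱼ ≠ vⱼ := fun e => hzⱼ cⱼ hcⱼ (e ▸ memⱼ.1)
  have hzⱼvⱼ' : zⱼ ≠ vⱼ' := fun e => hzⱼ cⱼ hcⱼ (e ▸ memⱼ.2)
  -- where `vⱼ` is live in `Γ₁`, `z` does not move `Γ₂`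
  have live : ∀ P : Fin n → Bool, (∀ j ∈ J₀, I.eval P j = y j) → P vⱼ' = false → mv I w₁.1 w₁.2.1 vⱼ P = true →
      mv I w₂.1 w₂.2.1 z P = false := by
    intro P hP hP0 hl
    have R := rank_one_out_priv hI ht hz hcⱼ hchⱼ hvⱼ hnoz hP hP0
    rw [mv_eq_false_of_invisible hI hS hvC hvG, hl] at R
    simpa using R
  -- the `zⱼ`-flip toggles `live₁(vⱼ)` and moves `mv₂ z` by `κ`
  set x' := Function.update x zⱼ (!x zⱼ) with hx'
  have hs' : ∀ j ∈ J₀, I.eval x' j = y j := solves_update_of_outside hzⱼ hx _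
  have h0' : x' vⱼ' = false := by rw [hx', Function.update_of_ne hzⱼvⱼ'.symm]; exact h0ⱼ
  have tog : mv I w₁.1 w₁.2.1 vⱼ x' = !mv I w₁.1 w₁.2.1 vⱼ x := by
    rw [hx', mv_flip_gate hI hS _ _ hpⱼ.symm hzⱼvⱼ x, decide_eq_true hgⱼ₁]; cases mv I w₁.1 w₁.2.1 vⱼ x <;> rfl
  have movz : mv I w₂.1 w₂.2.1 z x' = xor (mv I w₂.1 w₂.2.1 z x) (decide (zⱼ ∈ partners I w₂.2.1 z)) := by
    by_cases hκ : zⱼ ∈ partners I w₂.2.1 z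
    · obtain ⟨h, hh, hp⟩ := (mem_partners_iff I hI).1 hκ
      rw [decide_eq_true hκ, hx', mv_update_of_gate I _ _ hI hS hh hp x]; cases mv I w₂.1 w₂.2.1 z x <;> rfl
    · rw [decide_eq_false hκ, Bool.xor_false, hx']
      exact mv_update_of_ne I _ _ (fun h hh hp => hκ ((mem_partners_iff I hI).2 ⟨h, hh, hp⟩)) x _
  by_cases hl : mv I w₁.1 w₁.2.1 vⱼ x = true
  · rw [live x hx h0ⱼ hl, hl]; simp
  · have hl' : mv I w₁.1 w₁.2.1 vⱼ x' = true := by rw [tog]; simpa using hl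
    have := live x' hs' h0' hl'
    rw [movz] at this
    rw [Bool.eq_false_iff.2 hl]
    revert this; cases mv I w₂.1 w₂.2.1 z x <;> cases decide (zⱼ ∈ partners I w₂.2.1 z) <;> decide

/-- **A chord-local LINEAR G-constraint on variables off the chord is empty** (indicator test). -/
theorem eq_empty_of_chordLocal_lin (hI : I.IsPure xorAndPred) (hS : SimpleOverlap I) {c : Fin m} {P : Finset (Fin n)}
    (hP : ∀ u ∈ P, ∀ s : Fin 4, u ≠ I.vars c s) (h : ChordLocal I c P ∅) : P = ∅ := by
  classical
  obtain ⟨φ, hφ⟩ := h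
  refine eq_empty_of_forall_notMem fun u hu => ?_
  have e0 := hφ (fun _ => false)
  have e1 := hφ (Function.update (fun _ => false) u true)
  rw [Function.update_of_ne (hP u hu 0).symm, Function.update_of_ne (hP u hu 1).symm, Function.update_of_ne (hP u hu 2).symm,
    Function.update_of_ne (hP u hu 3).symm, ← e0, gval_false] at e1
  have hflip : Function.update (fun _ : Fin n => false) u true = Function.update (fun _ : Fin n => false) u (!(fun _ : Fin n => false) u) := rfl
  rw [hflip, gval_flip I _ _ hI, gval_false, mv_of_lin I hI hS hu (fun g hg => absurd hg (notMem_empty g))] at e1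
  exact absurd e1 (by decide)

/-- **κ = 0: the outside variable is INVISIBLE to `Γ₂`.**  If `mv₂ z` vanishes on the slice `(0,0)` of a slice-generic chord `cⱼ` (any menu) and no
monomial of `G₂` pairs `z` with a private of `cⱼ` (typed instance), then `z ∉ C₂` and no monomial of `G₂` contains `z`. -/
theorem invisible_of_mv₂_zero (hI : I.IsPure xorAndPred) (hT : Typed I) (hS : SimpleOverlap I) (hcⱼ : cⱼ ∈ J₀) (hchⱼ : IsChord I J₀ cⱼ)
    {𝒢 : Finset (Fin m)} (hgenⱼ : SliceGeneric I y J₀ cⱼ 𝒢)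
    (hno₂ : ∀ h ∈ w₂.2.1, ¬ ((I.vars h 2 = z ∧ I.vars h 3 = I.vars cⱼ 2) ∨ (I.vars h 2 = I.vars cⱼ 2 ∧ I.vars h 3 = z)))
    (hno₃ : ∀ h ∈ w₂.2.1, ¬ ((I.vars h 2 = z ∧ I.vars h 3 = I.vars cⱼ 3) ∨ (I.vars h 2 = I.vars cⱼ 3 ∧ I.vars h 3 = z)))
    (hM : ∀ P : Fin n → Bool, (∀ j ∈ J₀, I.eval P j = y j) → P (I.vars cⱼ 2) = false → P (I.vars cⱼ 3) = false → mv I w₂.1 w₂.2.1 z P = false)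
    (hex : ∃ P : Fin n → Bool, (∀ j ∈ J₀, I.eval P j = y j) ∧ P (I.vars cⱼ 2) = false ∧ P (I.vars cⱼ 3) = false) :
    z ∉ w₂.1 ∧ ∀ h ∈ w₂.2.1, I.vars h 2 ≠ z ∧ I.vars h 3 ≠ z := by
  classical
  set P₂ := partners I w₂.2.1 z with hP₂
  have hloc : ChordLocal I cⱼ P₂ ∅ := by
    refine chordLocal_of_fail_slice hI hcⱼ hchⱼ (sliceGeneric_mono (empty_subset 𝒢) hgenⱼ) (fun g hg => absurd hg (notMem_empty g))
      (Subset.refl _) false false (!decide (z ∈ w₂.1)) fun P hP hP2 hP3 h => ?_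
    have hMP := hM P hP hP2 hP3
    rw [mv_eq_partners I hI hS, ← hP₂, h] at hMP
    revert hMP; cases decide (z ∈ w₂.1) <;> decide
  have hPv : ∀ u ∈ P₂, ∀ s : Fin 4, u ≠ I.vars cⱼ s := by
    intro u hu s
    obtain ⟨h, hh, hhu⟩ := (mem_partners_iff I hI).1 (hP₂ ▸ hu)
    obtain ⟨t, ht2, htu⟩ : ∃ t : Fin 4, 2 ≤ t.val ∧ I.vars h t = u := by
      rcases hhu with ⟨-, h3⟩ | ⟨h2, -⟩
      exacts [⟨3, by decide, h3⟩, ⟨2, by decide, h2⟩]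
    intro e
    match s with
    | 0 => exact hT cⱼ h 0 t (by decide) ht2 (by rw [htu, e])
    | 1 => exact hT cⱼ h 1 t (by decide) ht2 (by rw [htu, e])
    | 2 => exact hno₂ h hh (by rw [← e]; exact hhu)
    | 3 => exact hno₃ h hh (by rw [← e]; exact hhu)
  have hempty : P₂ = ∅ := eq_empty_of_chordLocal_lin hI hS hPv hloc
  have hG₂ : ∀ h ∈ w₂.2.1, I.vars h 2 ≠ z ∧ I.vars h 3 ≠ z := forall_ne_of_partners_eq_empty I hI (hP₂ ▸ hempty)
  refine ⟨fun hC => ?_, hG₂⟩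
  obtain ⟨P, hP, hP2, hP3⟩ := hex
  have hMP := hM P hP hP2 hP3
  rw [mv_of_lin I hI hS hC hG₂] at hMP
  exact absurd hMP (by decide)

/-- **κ = 1: the outside variable is FULLY coupled.**  If on the slice `(0,0)` of a slice-generic chord `cⱼ` we have `mv₂ z = ¬ mv₁ vⱼ` (`vⱼ` a
private of `cⱼ` all of whose `G₁`-partners lie outside the core), no monomial of `G₂` pairs `z` with a private of `cⱼ`, and the instance is typed,
then the `G₂`-partners of `z` are EXACTLY the `G₁`-partners of `vⱼ`, and `z ∈ C₂ ↔ vⱼ ∉ C₁`. -/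
theorem full_of_mv₂_eq (hI : I.IsPure xorAndPred) (hT : Typed I) (hS : SimpleOverlap I) (hcⱼ : cⱼ ∈ J₀) (hchⱼ : IsChord I J₀ cⱼ)
    {𝒢 : Finset (Fin m)} (hgenⱼ : SliceGeneric I y J₀ cⱼ 𝒢)
    (hPout : ∀ u ∈ partners I w₁.2.1 vⱼ, ∀ j ∈ J₀, u ∉ varSet I j)
    (hno₂ : ∀ h ∈ w₂.2.1, ¬ ((I.vars h 2 = z ∧ I.vars h 3 = I.vars cⱼ 2) ∨ (I.vars h 2 = I.vars cⱼ 2 ∧ I.vars h 3 = z)))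
    (hno₃ : ∀ h ∈ w₂.2.1, ¬ ((I.vars h 2 = z ∧ I.vars h 3 = I.vars cⱼ 3) ∨ (I.vars h 2 = I.vars cⱼ 3 ∧ I.vars h 3 = z)))
    (hM : ∀ P : Fin n → Bool, (∀ j ∈ J₀, I.eval P j = y j) → P (I.vars cⱼ 2) = false → P (I.vars cⱼ 3) = false →
      mv I w₂.1 w₂.2.1 z P = !mv I w₁.1 w₁.2.1 vⱼ P)
    (hex : ∃ P : Fin n → Bool, (∀ j ∈ J₀, I.eval P j = y j) ∧ P (I.vars cⱼ 2) = false ∧ P (I.vars cⱼ 3) = false) :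
    partners I w₂.2.1 z = partners I w₁.2.1 vⱼ ∧ (z ∈ w₂.1 ↔ vⱼ ∉ w₁.1) := by
  classical
  set P₂ := partners I w₂.2.1 z with hP₂
  set P₁ := partners I w₁.2.1 vⱼ with hP₁
  -- the linear constraint `P₂ ∆ P₁` is constant on the slice
  have hconst : ∀ P : Fin n → Bool, (∀ j ∈ J₀, I.eval P j = y j) → P (I.vars cⱼ 2) = false → P (I.vars cⱼ 3) = false →
      gval I (P₂ ∆ P₁) ∅ P = !(xor (decide (z ∈ w₂.1)) (decide (vⱼ ∈ w₁.1))) := by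
    intro P hP hP2 hP3
    have h := hM P hP hP2 hP3
    rw [mv_eq_partners I hI hS, mv_eq_partners I hI hS, ← hP₂, ← hP₁] at h
    have e : (∅ : Finset (Fin m)) = ∅ ∆ ∅ := by simp
    rw [e, gval_symmDiff]
    revert h
    cases gval I P₂ ∅ P <;> cases gval I P₁ ∅ P <;> cases decide (z ∈ w₂.1) <;> cases decide (vⱼ ∈ w₁.1) <;> decide
  have hloc : ChordLocal I cⱼ (P₂ ∆ P₁) ∅ :=
    chordLocal_of_fail_slice hI hcⱼ hchⱼ (sliceGeneric_mono (empty_subset 𝒢) hgenⱼ) (fun g hg => absurd hg (notMem_empty g))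
      (Subset.refl _) false false (xor (decide (z ∈ w₂.1)) (decide (vⱼ ∈ w₁.1))) fun P hP hP2 hP3 h => by
        rw [hconst P hP hP2 hP3] at h
        revert h; cases xor (decide (z ∈ w₂.1)) (decide (vⱼ ∈ w₁.1)) <;> decide
  have hPv : ∀ u ∈ P₂ ∆ P₁, ∀ s : Fin 4, u ≠ I.vars cⱼ s := by
    intro u hu s
    rcases Finset.mem_symmDiff.1 hu with ⟨hu, -⟩ | ⟨hu, -⟩
    · obtain ⟨h, hh, hhu⟩ := (mem_partners_iff I hI).1 (hP₂ ▸ hu)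
      obtain ⟨t, ht2, htu⟩ : ∃ t : Fin 4, 2 ≤ t.val ∧ I.vars h t = u := by
        rcases hhu with ⟨-, h3⟩ | ⟨h2, -⟩
        exacts [⟨3, by decide, h3⟩, ⟨2, by decide, h2⟩]
      intro e
      match s with
      | 0 => exact hT cⱼ h 0 t (by decide) ht2 (by rw [htu, e])
      | 1 => exact hT cⱼ h 1 t (by decide) ht2 (by rw [htu, e])
      | 2 => exact hno₂ h hh (by rw [← e]; exact hhu)
      | 3 => exact hno₃ h hh (by rw [← e]; exact hhu)
    · exact fun e => hPout u (hP₁ ▸ hu) cⱼ hcⱼ (e ▸ vars_mem_varSet I cⱼ s)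
  have hempty : P₂ ∆ P₁ = ∅ := eq_empty_of_chordLocal_lin hI hS hPv hloc
  refine ⟨symmDiff_eq_bot.1 (hempty.trans Finset.bot_eq_empty.symm), ?_⟩
  obtain ⟨P, hP, hP2, hP3⟩ := hex
  have h := hconst P hP hP2 hP3
  rw [hempty, gval_empty] at h
  by_cases hz : z ∈ w₂.1 <;> by_cases hv : vⱼ ∈ w₁.1 <;> simp [hz, hv] at h ⊢

end Kappa

end Summit.PneNP.PneNP.Theorems.PstarChordReadPrivSwitch
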